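import Summits.BirchSwinnertonDyer.Rank1Residual.P2.CongruentNumberThetaStarTowersAoki
import Summits.BirchSwinnertonDyer.Rank1Residual.P2.CongruentNumberThetaStarSilentSminus
import Summits.BirchSwinnertonDyer.Rank1Residual.P2.CongruentNumberThetaStarTowersExist
import HarnessLib

/-!
# Cell `bsd-monsky` (prover-B): route B's uniform-in-`k` family theorems ON AOKI'S THEOREM 2.2 — the star family,
# the silent 𝒮⁻-towers and the existence theorems, relative to {`tyz_cmPointGaloisData`, TYZ Thm 1.1, GZK, `thm22_card_selmerGroup_two`}
# (kernel theorems; nothing asserted)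

HONEST FRAMING (cell `bsd-monsky`, run/shared/lean/pub/bsd-monsky/; README §1/§3): the cell's CLAIMED theorem is Monsky's
1990 conjecture on `𝒮⁻` (`k = 2`); the families below are the README §3 record «what the same argument gives», uniformly in the
number of prime factors — NOT part of Theorem 1.1/1.2, NOT refereed. This file asserts NO arithmetic fact: it re-derives the
headline statements of `…ThetaStarBSD.lean`, `…ThetaStarSilentSminus.lean` and `…ThetaStarTowersExist.lean` with Monsky's even
matrix theorem (`hMe`, appendix to Heath-Brown 1994, printed as a sketch) replaced by Aoki's refereed Theorem 2.2 (`hAo`),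
through «Aoki = Monsky for every k» (`AokiMonsky.monskyEven_six_of_aoki`, `…EvenAokiMonskyAllPrimes.lean`) and the doors of
`…EvenAokiMonskyDoors.lean` / `…ThetaStarTowersAoki.lean`:

* `rankOne_sha_bsdp_two_star_of_cmPointGaloisData_of_aoki` — the star family `n = 2qp₁⋯p_m`, `q ≡ 3 (mod 8)`;
* `silent_and_bsdp_two_sminus_tower_of_aoki` — the 𝒮⁻-towers with the silence of print (`Σ₂′(n)` even) explicit;
* `forall_exists_silent_sminus_tower_of_aoki`, `forall_exists_sminus_tower_over_of_aoki` — towers of every height above every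
  bound (Dirichlet + CRT, from `exists_tower_primes(_over)`).

References: [Aoki1999] Thm. 2.2 p. 81; [TianYuanZhang2017] Thm. 1.2, §1 (1.1), Thm. 1.1, Thm. 3.5; [Tian2014] Thm. 1.1, Thm. 5.2;
[Monsky1990MockHeegner] p. 67 Remark (3); [SilvermanAEC2009] Thm. X.4.2; [Miller2011LMS] Def. 1.1.
-/

noncomputable section

open scoped Classical

open Matrix Finset WeierstrassCurve Literature.NumberTheory.EllipticCurves
  Literature.NumberTheory.EllipticCurves.Rank1Residual
  Literature.NumberTheory.EllipticCurves.Rank1Residual.Typed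
  Literature.NumberTheory.EllipticCurves.HeathBrown1994
  Literature.NumberTheory.EllipticCurves.HeathBrown1994.Families
  Literature.NumberTheory.EllipticCurves.Aoki1999
  Literature.NumberTheory.EllipticCurves.Tian2014
  Literature.NumberTheory.EllipticCurves.TianYuanZhang2017
  Literature.NumberTheory.EllipticCurves.TianYuanZhang2017.W2
  Literature.NumberTheory.QuadraticFields.RedeiReichardt

set_option autoImplicit false

namespace Summit.BirchSwinnertonDyer.Rank1Residual.P2

namespace ThetaDescent

variable {m : ℕ} {q : ℕ} {p : Fin m → ℕ}

/-- **The star family on Aoki's theorem**: `q ≡ 3 (mod 8)`, `p₁, …, p_m ≡ 5 (mod 8)` distinct pairwise residues, at most one mark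
`(pᵢ/q) = −1`, `n = 2qp₁⋯p_m`: `ord = 1`, rank `1`, `Ш[2^∞] = 0`, `BSD(E_n, 2)` — verbatim `rankOne_sha_bsdp_two_star_of_cmPointGaloisData`
with the uniform door run on hAo. Relative to {`tyz_cmPointGaloisData`, TYZ Thm. 1.1, GZK, Aoki Thm. 2.2}; NOT refereed.
[cite: Aoki1999, Thm. 2.2 p. 81] [cite: TianYuanZhang2017, §1 (1.1), Thm. 3.5] [cite: Miller2011LMS, Def. 1.1 (arXiv:1010.2431 p. 3)] -/
theorem rankOne_sha_bsdp_two_star_of_cmPointGaloisData_of_aoki (hCM : tyz_cmPointGaloisData)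
    (hGZK : rank_eq_analyticRank_of_analyticRank_le_one) (hAo : thm22_card_selmerGroup_two) (h11 : thm11_parity_of_scriptL)
    (hq : q.Prime) (hq3 : q % 8 = 3) (hp : ∀ i, (p i).Prime) (hp5 : ∀ i, p i % 8 = 5) (hinj : Function.Injective p)
    (hQR : ∀ i j, i ≠ j → jacobiSym (p j) (p i) = 1) (hμ : ∀ i j, jacobiSym (p i) q = -1 → jacobiSym (p j) q = -1 → i = j) :
    (congruentNumberCurve (2 * (q * ∏ i, p i))).analyticRank = 1 ∧
      (congruentNumberCurve (2 * (q * ∏ i, p i))).mordellWeilRank = 1 ∧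
      AddCommGroup.primaryComponent (congruentNumberCurve (2 * (q * ∏ i, p i))).sha 2 = ⊥ ∧
      BSDp (congruentNumberCurve (2 * (q * ∏ i, p i))) 2 := by
  obtain ⟨-, x, hx0, hv, hx⟩ := rankOneDatum_star_of_cmPointGaloisData hCM hGZK h11 hq hq3 hp hp5 hinj hQR hμ
  have hn : 2 * ∏ i, (vecCons q p : Fin (m + 1) → ℕ) i = 2 * (q * ∏ i, p i) := by rw [prod_star_cons]
  obtain ⟨hr1, hrk, hsha, hiff⟩ :=
    rankOne_sha_bsdp_two_iff_congruentNumberCurve_two_mul_prod_of_aoki (vecCons q p : Fin (m + 1) → ℕ) hGZK hAo (star_cons_prime hq hp)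
      (star_cons_injective hq3 hp5 hinj) hn (star_mod_eight hq3 hp hp5 hinj) (monskySelmerRankEven_star hq hq3 hp hp5 hQR hμ) hx0 hx
  exact ⟨hr1, hrk, hsha, hiff.mpr hv⟩

/-- **THE 𝒮⁻-TOWER THEOREM with the silence of print made explicit, on Aoki's theorem**: for `(p₀, q) ∈ 𝒮⁻` and further distinct
primes `p₁, …, p_m ≡ 5 (mod 8)` that are residues of `q`, of `p₀` and of each other, `n = 2·q·p₀·p₁⋯p_m`: `Σ₂′(n)` is EVEN (TYZ Thm. 1.2
silent; modulo Rédei–Reichardt only) AND `ord = 1`, rank `1`, `Ш[2^∞] = 0`, `BSD(E_n, 2)` relative to {`tyz_cmPointGaloisData`,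
`thm11_parity_of_scriptL`, GZK, `thm22_card_selmerGroup_two`}. Nothing asserted; NOT refereed.
[cite: TianYuanZhang2017, Thm. 1.2 (p0002 L115–L127), §1 (1.1), Thm. 3.5] [cite: Aoki1999, Thm. 2.2 p. 81] [cite: Monsky1990MockHeegner, p. 67 Remark (3)] -/
theorem silent_and_bsdp_two_sminus_tower_of_aoki (hCM : tyz_cmPointGaloisData) (hGZK : rank_eq_analyticRank_of_analyticRank_le_one)
    (hAo : thm22_card_selmerGroup_two) (h11 : thm11_parity_of_scriptL) :
    ∀ (m p₀ q : ℕ) (p : Fin m → ℕ), p₀.Prime → q.Prime → p₀ % 8 = 5 → q % 4 = 3 → jacobiSym p₀ q = -1 →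
      (∀ i, (p i).Prime) → (∀ i, p i % 8 = 5) → Function.Injective p →
      (∀ i, jacobiSym (p i) q = 1) → (∀ i, jacobiSym (p i) p₀ = 1) → (∀ i j, i ≠ j → jacobiSym (p j) (p i) = 1) →
      Even (genusSum₂' (2 * (q * (p₀ * ∏ i, p i))) fun d => genusClassNumber (GenusField d)) ∧
        (congruentNumberCurve (2 * (q * (p₀ * ∏ i, p i)))).analyticRank = 1 ∧
        (congruentNumberCurve (2 * (q * (p₀ * ∏ i, p i)))).mordellWeilRank = 1 ∧
        AddCommGroup.primaryComponent (congruentNumberCurve (2 * (q * (p₀ * ∏ i, p i)))).sha 2 = ⊥ ∧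
        BSDp (congruentNumberCurve (2 * (q * (p₀ * ∏ i, p i)))) 2 :=
  fun m p₀ q p hp₀ hq h₀ hq4 hmark hp hp5 hinj hq1 hres hQR =>
    ⟨even_genusSum₂'_sminus_tower m p₀ q p hp₀ hq h₀ hq4 hmark hp hp5 hinj hq1 hres hQR,
      rankOne_sha_bsdp_two_sminus_tower_of_aoki hCM hGZK hAo h11 m p₀ q p hp₀ hq h₀ hq4 hmark hp hp5 hinj hq1 hres hQR⟩

/-- **For every `m` and every bound `B`: a TYZ-SILENT `n = 2·3·5·p₁⋯p_m` with `B < pᵢ ≡ 5 (mod 8)` on which `ord = 1`, rank `1`,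
`Ш[2^∞] = 0`, `BSD(E_n, 2)` hold — on Aoki's theorem** (verbatim `forall_exists_silent_sminus_tower`, hMe ↦ hAo). Relative to
{`tyz_cmPointGaloisData`, `thm11_parity_of_scriptL`, GZK, `thm22_card_selmerGroup_two`}; NOT refereed.
[cite: Tian2014, Thm. 1.1 (arXiv p. 1 L30–L33), Thm. 5.2] [cite: TianYuanZhang2017, Thm. 1.2 (p0002 L115–L127)] [cite: Aoki1999, Thm. 2.2 p. 81] -/
theorem forall_exists_silent_sminus_tower_of_aoki (hCM : tyz_cmPointGaloisData) (hGZK : rank_eq_analyticRank_of_analyticRank_le_one)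
    (hAo : thm22_card_selmerGroup_two) (h11 : thm11_parity_of_scriptL) (m B : ℕ) :
    ∃ p : Fin m → ℕ, (∀ i, (p i).Prime ∧ p i % 8 = 5 ∧ B < p i) ∧ Function.Injective p ∧
      Even (genusSum₂' (2 * (3 * (5 * ∏ i, p i))) fun d => genusClassNumber (GenusField d)) ∧
      (congruentNumberCurve (2 * (3 * (5 * ∏ i, p i)))).analyticRank = 1 ∧
      (congruentNumberCurve (2 * (3 * (5 * ∏ i, p i)))).mordellWeilRank = 1 ∧
      AddCommGroup.primaryComponent (congruentNumberCurve (2 * (3 * (5 * ∏ i, p i)))).sha 2 = ⊥ ∧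
      BSDp (congruentNumberCurve (2 * (3 * (5 * ∏ i, p i)))) 2 := by
  obtain ⟨p, hp, hp5, hpB, hinj, h3, h5, hQR⟩ := exists_tower_primes m B
  have h53 : jacobiSym (5 : ℕ) 3 = -1 := by norm_num
  exact ⟨p, fun i => ⟨hp i, hp5 i, hpB i⟩, hinj,
    silent_and_bsdp_two_sminus_tower_of_aoki hCM hGZK hAo h11 m 5 3 p (by norm_num) (by norm_num) (by norm_num) (by norm_num) h53
      hp hp5 hinj h3 h5 hQR⟩

/-- **Every pair of `𝒮⁻` carries towers of every height above every bound with (a)+(b) — on Aoki's theorem** (verbatim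
`forall_exists_sminus_tower_over`, hMe ↦ hAo). Relative to {`tyz_cmPointGaloisData`, `thm11_parity_of_scriptL`, GZK,
`thm22_card_selmerGroup_two`}; NOT refereed. [cite: Tian2014, Thm. 1.1, Thm. 5.2] [cite: Aoki1999, Thm. 2.2 p. 81]
[cite: TianYuanZhang2017, §1 (1.1), Thm. 3.5] -/
theorem forall_exists_sminus_tower_over_of_aoki (hCM : tyz_cmPointGaloisData) (hGZK : rank_eq_analyticRank_of_analyticRank_le_one)
    (hAo : thm22_card_selmerGroup_two) (h11 : thm11_parity_of_scriptL) {p₀ q : ℕ} (hp₀ : p₀.Prime) (hq : q.Prime)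
    (h₀ : p₀ % 8 = 5) (hq4 : q % 4 = 3) (hmark : jacobiSym p₀ q = -1) (m B : ℕ) :
    ∃ p : Fin m → ℕ, (∀ i, (p i).Prime ∧ p i % 8 = 5 ∧ B < p i) ∧ Function.Injective p ∧
      (congruentNumberCurve (2 * (q * (p₀ * ∏ i, p i)))).analyticRank = 1 ∧
      (congruentNumberCurve (2 * (q * (p₀ * ∏ i, p i)))).mordellWeilRank = 1 ∧
      AddCommGroup.primaryComponent (congruentNumberCurve (2 * (q * (p₀ * ∏ i, p i)))).sha 2 = ⊥ ∧
      BSDp (congruentNumberCurve (2 * (q * (p₀ * ∏ i, p i)))) 2 := by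
  obtain ⟨p, hp, hp5, hpB, hinj, hq1, hres, hQR⟩ := exists_tower_primes_over hp₀ hq h₀ hq4 m B
  exact ⟨p, fun i => ⟨hp i, hp5 i, hpB i⟩, hinj,
    rankOne_sha_bsdp_two_sminus_tower_of_aoki hCM hGZK hAo h11 m p₀ q p hp₀ hq h₀ hq4 hmark hp hp5 hinj hq1 hres hQR⟩

end ThetaDescent

end Summit.BirchSwinnertonDyer.Rank1Residual.P2

end
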